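import Summits.QuantumFields.YangMills.Theorems.SwapVirialDeficitSectorLaplaceMbDensityPointwise
import Summits.QuantumFields.YangMills.Theorems.SwapVirialDeficitBlowUpGnomonicFollowerLaplaceCeiling
import Summits.QuantumFields.YangMills.Theorems.SwapVirialDeficitSectorLaplaceGaussianBlockSplit
import Mathlib.Analysis.SpecialFunctions.Gaussian.GaussianIntegral
import Mathlib.MeasureTheory.Integral.Pi
import HarnessLib

/-!
# Route `SwapVirialDeficit` (YangMills): THE MORSE–BOTT DENSITY IS BOUNDED BELOW BY THE FOLLOWER DETERMINANT — `𝔪(a,ε,p) ≥ ρ(η₀)·((1+d)Λ)^{−7∕2}(1+1∕d)^{−d∕2}∕√det A_F(η₀)`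
# (cell ym-idea-1, skeleton ➎: brick (E3)(iv) of LEAD g99's memo10d for `stub_core_end` AND brick (T4c) of w2 g60's tip memo for `stub_core_tip` — the common CURRENCY
# CONVERTER between the cores' follower ceilings (✓`follower_laplace_ceiling`: `det A_F`) and the bulk main term `(2π∕b)^α·M_ε`, `M_ε = ∫∫𝔪`;
# free-hands support of ⟨stmt-QuantumFields-24197⟩ `SwapVirialDeficit.SwapGluedStiffness`)

At a bulk hub `a` (`re a ≠ 0`, `im a ≠ 0`), good signs `ε` and a base point `p = (x₀, y₀)` the Morse–Bott density of ✓`…SectorLaplaceDefs` is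
`𝔪(a,ε,p) = ρ(η₀)·(2π)^{−α}·∫_{V_L} e^{−½Q}`, `Q(y) = ⟪A(η₀) y, y⟫` the fibre Hessian form at `η₀ = gnoBase p` (✓`exists_gnoFibreHessian`), `2α = dim V_L = 7 + d`,
`d = 3|Fol L| = dim V_F`.  Splitting `V_L` into the leader-transverse block `(u, v, z)` (7 letters) and the follower block (✓`gnoFibreBlocksEquiv`, ✓`gnoFolToFibre`),
LEAD's Peter–Paul block inequality ✓`lintegral_prod_gaussian_block_ge` with `θ = 1∕d` gives
`∫ e^{−½Q} ≥ ∫_{ℝ⁷} e^{−½(1+d)Λ|ℓ|²} · ∫_{V_F} e^{−½(1+1∕d)⟪A_F f, f⟫}` (`Λ = 20400L⁴` ✓`abs_fibQ_le`; the follower block of `A(η₀)` IS the follower Hessian `A_F(η₀)` of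
✓`exists_gnoFolHessian`, §2), i.e.
* ★★★ `mbDensity_ge_detFol` — `ρ(gnoBase p)·((1+d)·20400L⁴)^{−7∕2}·(1+1∕d)^{−d∕2}·(det A_F(gnoBase p))^{−1∕2} ≤ 𝔪(a,ε,p)`, and with LEAD's
  ✓`exp_neg_half_le_one_add_inv_rpow`, ★★ `mbDensity_ge_detFol'` — the same with `e^{−1∕2}` in place of `(1+1∕d)^{−d∕2}`.
No `2^{−d∕2}`, no Fischer: the follower block loses only `e^{−1∕2}`, the seven leader letters a polynomial.

HONEST LABEL: measure ∕ linear-algebra plumbing at fixed `L`; `stub_core_tip`, `stub_core_end`, `stub_h001_good`, ⟨24197⟩ ∕ ⟨24194⟩ OPEN; own crux ⟨22884⟩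
`LargeFieldMassRefinementTail` OPEN (blocked-on ⟨19935⟩); the Yang–Mills mass gap is NOT proved; no summit is proved by a line.  THEOREMS ONLY (0 `def`, 0 `sorry`),
standard axioms, no instances.  Width seat ym-line-sfw-p2-w2 g60 (cell ym-idea-1, free hands),
`--supports stmt-QuantumFields-24197`.  References: [cite: Luscher1983, §2]; [cite: Breitung1994, Lemma 26]; [folklore].
-/

set_option autoImplicit false
set_option synthInstance.maxSize 1024

noncomputable section

open MeasureTheory Quaternion Set Module
open scoped Quaternion BigOperators ENNReal InnerProductSpace
open Literature.MathematicalPhysics.QuantumLattice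
open Literature.MathematicalPhysics.QuantumFieldTheory hiding SU2

namespace Summit.QuantumFields.YangMills.Theorems.SwapVirialDeficit.SectorLaplace

open Summit.QuantumFields.YangMills.Theorems.FemtoTransferGap
open Summit.QuantumFields.YangMills.Theorems.FemtoTransferGap.TT
open Summit.QuantumFields.YangMills.Theorems.VirialFluxGap.RingDeficit
open Summit.QuantumFields.YangMills.Theorems.SwapVirialDeficit.SwapRing
open Summit.QuantumFields.YangMills.Theorems.SwapVirialDeficit.BlowUpRing
open Summit.QuantumFields.YangMills.Theorems.SwapVirialDeficit.Gnomonic (normSq3 normSq3_nonneg)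
open Summit.QuantumFields.YangMills.Theorems.QuantitativeLaplace (integral_exp_neg_mul_half_inner integrable_exp_neg_mul_half_inner inner_pos_of_coercive)
open Literature.Analysis.Asymptotics (det_pos_of_inner_pos)

variable {L : ℕ} [NeZero L]

/-! ## §1 The one-dimensional and seven-dimensional Gaussians of the leader-transverse block -/

/-- The Gaussian on `Fin n → ℝ`: `∫ e^{−c Σ xᵢ²} = (√(π∕c))ⁿ`. [folklore] -/
theorem integral_exp_neg_mul_sumSq_pi (n : ℕ) (c : ℝ) :
    ∫ x : Fin n → ℝ, Real.exp (-(c * ∑ i, x i ^ 2)) = Real.sqrt (Real.pi / c) ^ n := by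
  have e : (fun x : Fin n → ℝ => Real.exp (-(c * ∑ i, x i ^ 2))) = fun x => ∏ i, Real.exp (-c * x i ^ 2) := by
    funext x; rw [← Real.exp_sum, Finset.mul_sum, ← Finset.sum_neg_distrib]; congr 1; refine Finset.sum_congr rfl fun i _ => by ring
  rw [e, integral_fintype_prod_volume_eq_pow (fun t : ℝ => Real.exp (-c * t ^ 2)), integral_gaussian, Fintype.card_fin]

/-- The Gaussian on `Fin n → ℝ` is integrable. [folklore] -/
theorem integrable_exp_neg_mul_sumSq_pi (n : ℕ) {c : ℝ} (hc : 0 < c) :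
    Integrable (fun x : Fin n → ℝ => Real.exp (-(c * ∑ i, x i ^ 2))) := by
  have e : (fun x : Fin n → ℝ => Real.exp (-(c * ∑ i, x i ^ 2))) = fun x => ∏ i, Real.exp (-c * x i ^ 2) := by
    funext x; rw [← Real.exp_sum, Finset.mul_sum, ← Finset.sum_neg_distrib]; congr 1; refine Finset.sum_congr rfl fun i _ => by ring
  rw [e]
  exact Integrable.fintype_prod_dep (f := fun (_ : Fin n) (t : ℝ) => Real.exp (-c * t ^ 2)) fun _ => integrable_exp_neg_mul_sq hc

/-- ★ **THE SEVEN-LETTER GAUSSIAN** of the leader-transverse block `(u, v, z) ∈ ℝ² × ℝ² × ℝ³`: `∫ e^{−c(|u|² + |v|² + |z|²)} = (√(π∕c))⁷`. [folklore] -/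
theorem integral_exp_neg_mul_blocksT (c : ℝ) :
    ∫ q : ((Fin 2 → ℝ) × (Fin 2 → ℝ)) × (Fin 3 → ℝ), Real.exp (-(c * ((∑ i, q.1.1 i ^ 2) + (∑ i, q.1.2 i ^ 2) + ∑ i, q.2 i ^ 2))) = Real.sqrt (Real.pi / c) ^ 7 := by
  have e : (fun q : ((Fin 2 → ℝ) × (Fin 2 → ℝ)) × (Fin 3 → ℝ) => Real.exp (-(c * ((∑ i, q.1.1 i ^ 2) + (∑ i, q.1.2 i ^ 2) + ∑ i, q.2 i ^ 2)))) =
      fun q => (Real.exp (-(c * ∑ i, q.1.1 i ^ 2)) * Real.exp (-(c * ∑ i, q.1.2 i ^ 2))) * Real.exp (-(c * ∑ i, q.2 i ^ 2)) := by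
    funext q; rw [← Real.exp_add, ← Real.exp_add]; ring_nf
  rw [e]
  have h1 : ∫ q : ((Fin 2 → ℝ) × (Fin 2 → ℝ)) × (Fin 3 → ℝ), (Real.exp (-(c * ∑ i, q.1.1 i ^ 2)) * Real.exp (-(c * ∑ i, q.1.2 i ^ 2))) * Real.exp (-(c * ∑ i, q.2 i ^ 2)) =
      (∫ uv : (Fin 2 → ℝ) × (Fin 2 → ℝ), Real.exp (-(c * ∑ i, uv.1 i ^ 2)) * Real.exp (-(c * ∑ i, uv.2 i ^ 2))) * ∫ z : Fin 3 → ℝ, Real.exp (-(c * ∑ i, z i ^ 2)) := by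
    rw [MeasureTheory.Measure.volume_eq_prod]
    exact integral_prod_mul (fun uv : (Fin 2 → ℝ) × (Fin 2 → ℝ) => Real.exp (-(c * ∑ i, uv.1 i ^ 2)) * Real.exp (-(c * ∑ i, uv.2 i ^ 2)))
      (fun z : Fin 3 → ℝ => Real.exp (-(c * ∑ i, z i ^ 2)))
  have h2 : ∫ uv : (Fin 2 → ℝ) × (Fin 2 → ℝ), Real.exp (-(c * ∑ i, uv.1 i ^ 2)) * Real.exp (-(c * ∑ i, uv.2 i ^ 2)) =
      (∫ u : Fin 2 → ℝ, Real.exp (-(c * ∑ i, u i ^ 2))) * ∫ v : Fin 2 → ℝ, Real.exp (-(c * ∑ i, v i ^ 2)) := by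
    rw [MeasureTheory.Measure.volume_eq_prod]
    exact integral_prod_mul (fun u : Fin 2 → ℝ => Real.exp (-(c * ∑ i, u i ^ 2))) (fun v : Fin 2 → ℝ => Real.exp (-(c * ∑ i, v i ^ 2)))
  rw [h1, h2, integral_exp_neg_mul_sumSq_pi 2, integral_exp_neg_mul_sumSq_pi 3]
  ring

/-- The seven-letter Gaussian is integrable. [folklore] -/
theorem integrable_exp_neg_mul_blocksT {c : ℝ} (hc : 0 < c) :
    Integrable fun q : ((Fin 2 → ℝ) × (Fin 2 → ℝ)) × (Fin 3 → ℝ) => Real.exp (-(c * ((∑ i, q.1.1 i ^ 2) + (∑ i, q.1.2 i ^ 2) + ∑ i, q.2 i ^ 2))) := by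
  have e : (fun q : ((Fin 2 → ℝ) × (Fin 2 → ℝ)) × (Fin 3 → ℝ) => Real.exp (-(c * ((∑ i, q.1.1 i ^ 2) + (∑ i, q.1.2 i ^ 2) + ∑ i, q.2 i ^ 2)))) =
      fun q => (Real.exp (-(c * ∑ i, q.1.1 i ^ 2)) * Real.exp (-(c * ∑ i, q.1.2 i ^ 2))) * Real.exp (-(c * ∑ i, q.2 i ^ 2)) := by
    funext q; rw [← Real.exp_add, ← Real.exp_add]; ring_nf
  rw [e]
  exact ((integrable_exp_neg_mul_sumSq_pi 2 hc).mul_prod (integrable_exp_neg_mul_sumSq_pi 2 hc)).mul_prod (integrable_exp_neg_mul_sumSq_pi 3 hc)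

/-! ## §2 The follower block of the fibre Hessian is the follower Hessian -/

/-- ★ **THE FOLLOWER BLOCK OF `A(η)` IS `A_F(η)`**: for the fibre family `A` of ✓`exists_gnoFibreHessian` and the follower family `A_F` of ✓`exists_gnoFolHessian` (form identities),
`⟪A η (gnoFolToFibre f), gnoFolToFibre f⟫ = ⟪A_F η f, f⟫` (the follower restriction is the fibre restriction composed with the isometric inclusion, ✓`gnoDeficit_fol_eq_comp`).
[folklore] -/
theorem inner_gnoFibreHessian_fol (z : Fin 3 → Bool) (χ : Site 3 L → SU2) {a : ℍ} (ha : a ≠ 0) (ε : GnoSign L)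
    {A : GnoCoord L → GnoFibre L →ₗ[ℝ] GnoFibre L}
    (hAyy : ∀ η (y : GnoFibre L), ⟪A η y, y⟫_ℝ = iteratedFDeriv ℝ 2 (fun y' : GnoFibre L => gnoDeficit z χ a ε (η + gnoFibreEmb y')) 0 (fun _ => y))
    {AF : GnoCoord L → GnoFol L →ₗ[ℝ] GnoFol L}
    (hFyy : ∀ η (y : GnoFol L), ⟪AF η y, y⟫_ℝ = iteratedFDeriv ℝ 2 (fun y' : GnoFol L => gnoDeficit z χ a ε (η + gnoFolEmb y')) 0 (fun _ => y))
    (η : GnoCoord L) (f : GnoFol L) :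
    ⟪A η (gnoFolToFibre f), gnoFolToFibre f⟫_ℝ = ⟪AF η f, f⟫_ℝ := by
  have h2 : (2 : WithTop ℕ∞) ≤ ((2 : ℕ∞) : WithTop ℕ∞) := le_rfl
  rw [hAyy, hFyy, gnoDeficit_fol_eq_comp, ContinuousLinearMap.iteratedFDeriv_comp_right _ (contDiff_gnoDeficit_fibre (n := 2) z χ ha ε η) _ h2]
  simp

/-! ## §3 The lower bound -/

set_option maxHeartbeats 400000 in
/-- ★★★ **THE MORSE–BOTT DENSITY IS BOUNDED BELOW BY THE FOLLOWER DETERMINANT.**  Hub `a` with `re a ≠ 0`, `im a ≠ 0`, good signs `ε`, base point `p`; `A_F` a symmetric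
follower family with the form identity at the hub `a` (✓`exists_gnoFolHessian`).  Then, with `d = dim V_F = 3|Fol L|` and `Λ = 20400L⁴`,
`gnoDensity(gnoBase p)·((1+d)Λ)^{−7∕2}·(1+1∕d)^{−d∕2}·(det A_F(gnoBase p))^{−1∕2} ≤ 𝔪(a,ε,p)`. [cite: Breitung1994, Lemma 26] [cite: Luscher1983, §2] -/
theorem mbDensity_ge_detFol {a : ℍ} (hre : a.re ≠ 0) (him : a.im ≠ 0) {ε : GnoSign L} (hε : GoodSign ε) (p : ℝ × ℝ)
    {AF : GnoCoord L → GnoFol L →ₗ[ℝ] GnoFol L} (hFs : ∀ η, (AF η).IsSymmetric)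
    (hFyy : ∀ η (y : GnoFol L), ⟪AF η y, y⟫_ℝ = iteratedFDeriv ℝ 2 (fun y' : GnoFol L => gnoDeficit z₀ (fun _ => 1) a ε (η + gnoFolEmb y')) 0 (fun _ => y)) :
    gnoDensity (gnoBase p.1 p.2 : GnoCoord L) * (((1 + (finrank ℝ (GnoFol L) : ℝ)) * (20400 * (L : ℝ) ^ 4)) ^ (-(7 / 2 : ℝ)) *
        (1 + 1 / (finrank ℝ (GnoFol L) : ℝ)) ^ (-((finrank ℝ (GnoFol L) : ℝ) / 2)) / Real.sqrt (LinearMap.det (AF (gnoBase p.1 p.2)))) ≤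
      mbDensity (L := L) a ε p := by
  have ha : a ≠ 0 := fun h => hre (by rw [h]; rfl)
  have hL : (0 : ℝ) < (L : ℝ) := Nat.cast_pos.2 (Nat.pos_of_ne_zero (NeZero.ne L))
  set η₀ : GnoCoord L := gnoBase p.1 p.2 with hη₀
  set Λ : ℝ := 20400 * (L : ℝ) ^ 4 with hΛ
  have hΛpos : 0 < Λ := by rw [hΛ]; positivity
  -- dimensions (opaque)
  have hd9 := nine_le_finrank_gnoFol (L := L)
  obtain ⟨d, hd⟩ : ∃ d : ℝ, (finrank ℝ (GnoFol L) : ℝ) = d := ⟨_, rfl⟩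
  rw [hd] at hd9 ⊢
  have hdpos : 0 < d := by linarith
  have hdn : (finrank ℝ (GnoFol L) : ℝ) = 3 * (Fintype.card (Fol L) : ℝ) := finrank_gnoFol_real (L := L)
  have hdimL : (finrank ℝ (GnoFibre L) : ℝ) = 7 + d := by
    rw [← hd, hdn]
    have h := card_gnoFibreIdx (L := L)
    rw [finrank_euclideanSpace, h]; push_cast; ring
  -- the fibre Hessian at η₀ and the quadratic form
  obtain ⟨A, hAs, -, hAyy, hAray, hAm, hAbd, -⟩ := exists_gnoFibreHessian z₀ (fun _ => 1) ha ε
  have hQ : ∀ y : GnoFibre L, fibQ a ε p y = ⟪A η₀ y, y⟫_ℝ := fun y => (hAray η₀ y).symm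
  -- coercivity of the fibre form and of the follower block
  set lam : ℝ := min (min (2 * (2 * (‖a‖⁻¹ * a.re) * (‖a‖⁻¹ * ‖a.im‖)) ^ 2 / ((2 + p.1 ^ 2) * (16200 * (L : ℝ) ^ 6)))
        (2 * (‖a‖⁻¹ * ‖a.im‖) ^ 2 / ((2 + p.2 ^ 2) * (16200 * (L : ℝ) ^ 6))))
      (min (1 / (16200 * (L : ℝ) ^ 6)) ((2304 * (L : ℝ) ^ 6 * (Fintype.card (Fol L) : ℝ))⁻¹ / 2)) with hlam
  have hlampos : 0 < lam := lam_explicit_pos hre him p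
  have hcoerA : ∀ y : GnoFibre L, lam * ‖y‖ ^ 2 ≤ ⟪A η₀ y, y⟫_ℝ := fun y => by rw [← hQ]; exact fibQ_coercive_explicit hre him hε p y
  have hfol : ∀ f : GnoFol L, ⟪A η₀ (gnoFolToFibre f), gnoFolToFibre f⟫_ℝ = ⟪AF η₀ f, f⟫_ℝ := fun f =>
    inner_gnoFibreHessian_fol z₀ (fun _ => 1) ha ε hAyy hFyy η₀ f
  have hcoerF : ∀ f : GnoFol L, lam * ‖f‖ ^ 2 ≤ ⟪AF η₀ f, f⟫_ℝ := fun f => by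
    rw [← hfol, ← norm_gnoFolToFibre f]; exact hcoerA _
  have hdetF : 0 < LinearMap.det (AF η₀) := det_pos_of_inner_pos (hFs η₀) (inner_pos_of_coercive hlampos hcoerF)
  -- the bilinear form
  set B : GnoFibre L →ₗ[ℝ] GnoFibre L →ₗ[ℝ] ℝ :=
    LinearMap.mk₂ ℝ (fun v w : GnoFibre L => ⟪A η₀ v, w⟫_ℝ) (fun v v' w => by rw [map_add, inner_add_left]) (fun c v w => by rw [map_smul, real_inner_smul_left, smul_eq_mul])
      (fun v w w' => by rw [inner_add_right]) (fun c v w => by rw [real_inner_smul_right, smul_eq_mul]) with hB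
  have hBapp : ∀ v w : GnoFibre L, B v w = ⟪A η₀ v, w⟫_ℝ := fun v w => rfl
  have hBsym : ∀ v w, B v w = B w v := fun v w => by rw [hBapp, hBapp, hAs η₀ v w]; exact real_inner_comm (A η₀ w) v
  have hBpsd : ∀ v, 0 ≤ B v v := fun v => by rw [hBapp]; exact le_trans (mul_nonneg hlampos.le (sq_nonneg _)) (hcoerA v)
  -- the block maps
  set E : GnoFibre L ≃ᵐ ((Fin 2 → ℝ) × (Fin 2 → ℝ)) × (Fin 3 → ℝ) × (Fol L → Fin 3 → ℝ) := gnoFibreBlocksEquiv (L := L) with hE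
  set ι₁ : ((Fin 2 → ℝ) × (Fin 2 → ℝ)) × (Fin 3 → ℝ) → GnoFibre L := fun ℓ => E.symm (ℓ.1, (ℓ.2, (0 : Fol L → Fin 3 → ℝ))) with hι₁
  set ι₂ : (Fol L → Fin 3 → ℝ) → GnoFibre L := fun F => E.symm (((0 : Fin 2 → ℝ), (0 : Fin 2 → ℝ)), ((0 : Fin 3 → ℝ), F)) with hι₂
  have hEadd : ∀ y y' : GnoFibre L, E (y + y') = E y + E y' := fun y y' => by
    show gnoFibreBlocks (y + y') = gnoFibreBlocks y + gnoFibreBlocks y'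
    rfl
  have hdecomp : ∀ (ℓ : ((Fin 2 → ℝ) × (Fin 2 → ℝ)) × (Fin 3 → ℝ)) (F : Fol L → Fin 3 → ℝ), E.symm (ℓ.1, (ℓ.2, F)) = ι₁ ℓ + ι₂ F := fun ℓ F => by
    apply E.injective
    rw [hEadd, hι₁, hι₂, E.apply_symm_apply, E.apply_symm_apply, E.apply_symm_apply]
    simp
  have hι₂fol : ∀ f : GnoFol L, ι₂ (gnoFolBlocksEquiv f) = gnoFolToFibre f := fun f => by
    rw [hι₂]
    apply E.injective
    rw [E.apply_symm_apply, hE, gnoFibreBlocksEquiv_apply, gnoFibreBlocks_gnoFolToFibre, gnoFolBlocksEquiv_apply]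
  -- norm of the leader-transverse block
  have hnorm₁ : ∀ ℓ : ((Fin 2 → ℝ) × (Fin 2 → ℝ)) × (Fin 3 → ℝ), ‖ι₁ ℓ‖ ^ 2 = (∑ i, ℓ.1.1 i ^ 2) + (∑ i, ℓ.1.2 i ^ 2) + ∑ i, ℓ.2 i ^ 2 := fun ℓ => by
    have h := norm_sq_gnoFibre (ι₁ ℓ)
    have hb : gnoFibreBlocks (ι₁ ℓ) = (ℓ.1, (ℓ.2, (0 : Fol L → Fin 3 → ℝ))) := by
      rw [← gnoFibreBlocksEquiv_apply, ← hE, hι₁, E.apply_symm_apply]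
    rw [hb] at h
    simp only [Fin.sum_univ_two, Fin.sum_univ_three, normSq3, Pi.zero_apply] at h ⊢
    rw [h]
    simp [Finset.sum_const_zero]
  -- §A the block inequality (LEAD): θ = 1/d, c = 1/2
  have hθ : 0 < 1 / d := by positivity
  have hmeasB : Measurable fun y : GnoFibre L => B y y := by
    have e : (fun y : GnoFibre L => B y y) = fun y => fibQ a ε p y := funext fun y => by rw [hBapp, hQ]
    rw [e]; exact measurable_fibQ ha ε p
  have hmι₁ : Measurable ι₁ := E.symm.measurable.comp (measurable_fst.prodMk (measurable_snd.prodMk measurable_const))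
  have hmι₂ : Measurable ι₂ := E.symm.measurable.comp (measurable_const.prodMk (measurable_const.prodMk measurable_id))
  have hblock := lintegral_prod_gaussian_block_ge (volume : Measure (((Fin 2 → ℝ) × (Fin 2 → ℝ)) × (Fin 3 → ℝ))) (volume : Measure (Fol L → Fin 3 → ℝ))
    B hBsym hBpsd hθ (by norm_num : (0 : ℝ) ≤ 1 / 2) ι₁ ι₂ (hmeasB.comp hmι₁).aemeasurable (hmeasB.comp hmι₂).aemeasurable
  -- §B the right side is ∫_{V_L} e^{−½Q}
  have hRHS : ∫⁻ q : (((Fin 2 → ℝ) × (Fin 2 → ℝ)) × (Fin 3 → ℝ)) × (Fol L → Fin 3 → ℝ), ENNReal.ofReal (Real.exp (-(1 / 2 * B (ι₁ q.1 + ι₂ q.2) (ι₁ q.1 + ι₂ q.2))))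
      ∂((volume : Measure (((Fin 2 → ℝ) × (Fin 2 → ℝ)) × (Fin 3 → ℝ))).prod (volume : Measure (Fol L → Fin 3 → ℝ))) =
      ∫⁻ y : GnoFibre L, ENNReal.ofReal (Real.exp (-(fibQ a ε p y / 2))) := by
    -- through `prodAssoc` and `E.symm`
    have hG : Measurable fun y : GnoFibre L => ENNReal.ofReal (Real.exp (-(fibQ a ε p y / 2))) :=
      ENNReal.measurable_ofReal.comp (Real.measurable_exp.comp ((measurable_fibQ ha ε p).div_const 2).neg)
    have h1 : ∫⁻ y : GnoFibre L, ENNReal.ofReal (Real.exp (-(fibQ a ε p y / 2))) =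
        ∫⁻ b, ENNReal.ofReal (Real.exp (-(fibQ a ε p (E.symm b) / 2))) ∂(volume : Measure (((Fin 2 → ℝ) × (Fin 2 → ℝ)) × (Fin 3 → ℝ) × (Fol L → Fin 3 → ℝ))) := by
      rw [← (volume_preserving_gnoFibreBlocksEquiv (L := L)).symm.lintegral_comp_emb E.symm.measurableEmbedding]
    have h2 : (volume : Measure (((Fin 2 → ℝ) × (Fin 2 → ℝ)) × (Fin 3 → ℝ) × (Fol L → Fin 3 → ℝ))) =
        Measure.map MeasurableEquiv.prodAssoc (((volume : Measure ((Fin 2 → ℝ) × (Fin 2 → ℝ))).prod (volume : Measure (Fin 3 → ℝ))).prod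
          (volume : Measure (Fol L → Fin 3 → ℝ))) := by
      rw [Measure.prodAssoc_prod]; rfl
    have hG' : Measurable fun b : ((Fin 2 → ℝ) × (Fin 2 → ℝ)) × (Fin 3 → ℝ) × (Fol L → Fin 3 → ℝ) => ENNReal.ofReal (Real.exp (-(fibQ a ε p (E.symm b) / 2))) :=
      hG.comp E.symm.measurable
    rw [h1, h2, lintegral_map hG' MeasurableEquiv.prodAssoc.measurable]
    refine lintegral_congr fun q => ?_
    simp only [MeasurableEquiv.prodAssoc, MeasurableEquiv.coe_mk, Equiv.prodAssoc_apply]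
    rw [hdecomp (q.1.1, q.1.2) q.2, hBapp, ← hQ]
    ring_nf
  -- §C the follower factor
  have hfolInt : ∫⁻ F : Fol L → Fin 3 → ℝ, ENNReal.ofReal (Real.exp (-(1 / 2 * ((1 + 1 / d) * B (ι₂ F) (ι₂ F))))) =
      ENNReal.ofReal ((2 * Real.pi / (1 + 1 / d)) ^ (d / 2) / Real.sqrt (LinearMap.det (AF η₀))) := by
    have hs : 0 < 1 + 1 / d := by positivity
    have h1 : ∫⁻ F : Fol L → Fin 3 → ℝ, ENNReal.ofReal (Real.exp (-(1 / 2 * ((1 + 1 / d) * B (ι₂ F) (ι₂ F))))) =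
        ∫⁻ f : GnoFol L, ENNReal.ofReal (Real.exp (-((1 + 1 / d) * ((1 / 2) * ⟪AF η₀ f, f⟫_ℝ)))) := by
      have hm : Measurable fun F : Fol L → Fin 3 → ℝ => ENNReal.ofReal (Real.exp (-(1 / 2 * ((1 + 1 / d) * B (ι₂ F) (ι₂ F))))) :=
        ENNReal.measurable_ofReal.comp (Real.measurable_exp.comp (((hmeasB.comp hmι₂).const_mul _).const_mul _).neg)
      rw [← (volume_preserving_gnoFolBlocksEquiv (L := L)).lintegral_comp hm]
      refine lintegral_congr fun f => ?_
      rw [hι₂fol, hBapp, hfol]; ring_nf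
    rw [h1, ← ofReal_integral_eq_lintegral_ofReal (integrable_exp_neg_mul_half_inner hlampos hcoerF hs) (ae_of_all _ fun f => (Real.exp_pos _).le),
      integral_exp_neg_mul_half_inner (hFs η₀) hlampos hcoerF hs, hd]
  -- §D the leader-transverse factor
  have hleadInt : ENNReal.ofReal (Real.sqrt (Real.pi / (1 / 2 * ((1 + d) * Λ))) ^ 7) ≤
      ∫⁻ ℓ : ((Fin 2 → ℝ) × (Fin 2 → ℝ)) × (Fin 3 → ℝ), ENNReal.ofReal (Real.exp (-(1 / 2 * ((1 + d) * B (ι₁ ℓ) (ι₁ ℓ))))) := by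
    have hc : 0 < 1 / 2 * ((1 + d) * Λ) := by positivity
    rw [← integral_exp_neg_mul_blocksT, ofReal_integral_eq_lintegral_ofReal (integrable_exp_neg_mul_blocksT hc) (ae_of_all _ fun q => (Real.exp_pos _).le)]
    refine lintegral_mono fun ℓ => ENNReal.ofReal_le_ofReal (Real.exp_le_exp.2 (neg_le_neg ?_))
    rw [hBapp]
    have h := (abs_le.1 (hAbd η₀ (ι₁ ℓ))).2
    rw [hnorm₁] at h
    have hd1 : 0 ≤ 1 + d := by linarith
    nlinarith [h, hd1]
  -- §E assemble in `ℝ≥0∞`, then in `ℝ`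
  have hchain : ENNReal.ofReal (Real.sqrt (Real.pi / (1 / 2 * ((1 + d) * Λ))) ^ 7) * ENNReal.ofReal ((2 * Real.pi / (1 + 1 / d)) ^ (d / 2) / Real.sqrt (LinearMap.det (AF η₀))) ≤
      ∫⁻ y : GnoFibre L, ENNReal.ofReal (Real.exp (-(fibQ a ε p y / 2))) := by
    rw [← hRHS, ← hfolInt]
    have hθinv : (1 / d)⁻¹ = d := by rw [one_div, inv_inv]
    rw [hθinv] at hblock
    exact le_trans (mul_le_mul' hleadInt le_rfl) hblock
  -- back to real integrals
  have hint := integrable_exp_neg_fibQ_half hre him hε p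
  rw [← ofReal_integral_eq_lintegral_ofReal hint (ae_of_all _ fun y => (Real.exp_pos _).le), ← ENNReal.ofReal_mul (by positivity)] at hchain
  have hIpos : 0 ≤ ∫ y : GnoFibre L, Real.exp (-(fibQ a ε p y / 2)) := integral_nonneg fun y => (Real.exp_pos _).le
  have hreal := (ENNReal.ofReal_le_ofReal_iff hIpos).1 hchain
  -- the normalisation `(2π)^{−α}`, `α = (7 + d)/2`
  unfold mbDensity alpha
  rw [hdimL]
  have hρ : 0 ≤ gnoDensity (gnoBase p.1 p.2 : GnoCoord L) := (gnoDensity_pos _).le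
  rw [mul_assoc]
  refine mul_le_mul_of_nonneg_left ?_ hρ
  -- target: ((1+d)Λ)^{-7/2} (1+1/d)^{-d/2} / √det ≤ ((2π)^{(7+d)/2})⁻¹ * ∫ e^{-Q/2}
  have hsqrt7 : Real.sqrt (Real.pi / (1 / 2 * ((1 + d) * Λ))) ^ 7 = (2 * Real.pi) ^ ((7 : ℝ) / 2) * ((1 + d) * Λ) ^ (-(7 / 2 : ℝ)) := by
    have hx : 0 < (1 + d) * Λ := by positivity
    rw [show Real.pi / (1 / 2 * ((1 + d) * Λ)) = 2 * Real.pi / ((1 + d) * Λ) by field_simp, Real.sqrt_eq_rpow, ← Real.rpow_natCast,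
      ← Real.rpow_mul (by positivity), Real.div_rpow (by positivity) hx.le, Real.rpow_neg hx.le, div_eq_mul_inv]
    norm_num
  have hpow : (2 * Real.pi / (1 + 1 / d)) ^ (d / 2) = (2 * Real.pi) ^ (d / 2) * (1 + 1 / d) ^ (-(d / 2)) := by
    rw [Real.div_rpow (by positivity) (by positivity), Real.rpow_neg (by positivity), div_eq_mul_inv]
  have h2pi : (2 * Real.pi) ^ ((7 + d) / 2) = (2 * Real.pi) ^ ((7 : ℝ) / 2) * (2 * Real.pi) ^ (d / 2) := by
    rw [← Real.rpow_add (by positivity)]; ring_nf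
  rw [hsqrt7, hpow] at hreal
  have h2pipos : 0 < (2 * Real.pi) ^ ((7 + d) / 2) := by positivity
  rw [le_inv_mul_iff₀ h2pipos, h2pi]
  calc (2 * Real.pi) ^ ((7 : ℝ) / 2) * (2 * Real.pi) ^ (d / 2) * (((1 + d) * Λ) ^ (-(7 / 2 : ℝ)) * (1 + 1 / d) ^ (-(d / 2)) / Real.sqrt (LinearMap.det (AF η₀)))
      = (2 * Real.pi) ^ ((7 : ℝ) / 2) * ((1 + d) * Λ) ^ (-(7 / 2 : ℝ)) * ((2 * Real.pi) ^ (d / 2) * (1 + 1 / d) ^ (-(d / 2)) / Real.sqrt (LinearMap.det (AF η₀))) := by ring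
    _ ≤ ∫ y : GnoFibre L, Real.exp (-(fibQ a ε p y / 2)) := hreal

/-- ★★ **The same with the absolute constant `e^{−1∕2}`** (LEAD's ✓`exp_neg_half_le_one_add_inv_rpow`: `e^{−1∕2} ≤ (1 + 1∕d)^{−d∕2}`):
`gnoDensity(gnoBase p)·((1+d)·20400L⁴)^{−7∕2}·e^{−1∕2}·(det A_F(gnoBase p))^{−1∕2} ≤ 𝔪(a,ε,p)`. [cite: Breitung1994, Lemma 26] -/
theorem mbDensity_ge_detFol' {a : ℍ} (hre : a.re ≠ 0) (him : a.im ≠ 0) {ε : GnoSign L} (hε : GoodSign ε) (p : ℝ × ℝ)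
    {AF : GnoCoord L → GnoFol L →ₗ[ℝ] GnoFol L} (hFs : ∀ η, (AF η).IsSymmetric)
    (hFyy : ∀ η (y : GnoFol L), ⟪AF η y, y⟫_ℝ = iteratedFDeriv ℝ 2 (fun y' : GnoFol L => gnoDeficit z₀ (fun _ => 1) a ε (η + gnoFolEmb y')) 0 (fun _ => y)) :
    gnoDensity (gnoBase p.1 p.2 : GnoCoord L) * (((1 + (finrank ℝ (GnoFol L) : ℝ)) * (20400 * (L : ℝ) ^ 4)) ^ (-(7 / 2 : ℝ)) *
        Real.exp (-(1 / 2 : ℝ)) / Real.sqrt (LinearMap.det (AF (gnoBase p.1 p.2)))) ≤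
      mbDensity (L := L) a ε p := by
  refine le_trans ?_ (mbDensity_ge_detFol hre him hε p hFs hFyy)
  have hρ : 0 ≤ gnoDensity (gnoBase p.1 p.2 : GnoCoord L) := (gnoDensity_pos _).le
  refine mul_le_mul_of_nonneg_left (div_le_div_of_nonneg_right (mul_le_mul_of_nonneg_left ?_ (Real.rpow_nonneg (by positivity) _)) (Real.sqrt_nonneg _)) hρ
  have h := exp_neg_half_le_one_add_inv_rpow (finrank ℝ (GnoFol L))
  exact h

end Summit.QuantumFields.YangMills.Theorems.SwapVirialDeficit.SectorLaplace

end
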